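import Summits.CriticalPhenomena.PercolationContinuityZ3.Theorems.PercNearOneGluingNoHeavyLowerTailThreePointProductFormBoxAlpha

/-!
# The box theorem, discriminant step: `A(N_θ z) = (d²/4)·A(z) + [s²·L₁(z) + sd·W(z) + d²·R₂(z)]`
# (Sahi programme, one-child boundary-star cycle, prover prim-sahi-p2 gen 67)

Support file (`--supports stmt-CriticalPhenomena-4575`).  Standard axioms, no sorries, no named facts.  Memo
`run/shared/lean/prim/prim-sahi/FROM-prim-sahi-p2-gen67-BOX-ONESIDED.md` §8 (hierarchy), `prim-sahi-p2/PROOF-E3.md` §77.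

Regrouping the exact recursion `alpha_bstep` (`…ProductFormBoxAlpha`) by powers of the letter: for ARBITRARY states `(v,u)` and every
letter `(s,d)`,
  `A(N_θ(v,u)) = (d²/4)·A(v,u) + s²·L₁(v,u) + s·d·W(v,u) + d²·R₂(v,u)`      (`alpha_bstep_split`)
with the three LINEAR functionals
* `L₁ = (5/4)A − (3/2)t − (45/28)G + (1905/8)b̃ + (255/8)b̃₋ + 3ε` — the HUB LOOKAHEAD: `L₁(v,u) = A(N_{(1,0)}(v,u))` (`L1_eq_hub`),
* `W  = 60η₋ − 30·o₁ − 30((3/4)f₁ + (37/16)f₂)` — the odd kick,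
* `R₂ = (5/4)(4v₁ + 23v₂) + (105/8)b̃ + (135/8)b̃₋ + 3ε` — nonnegative on every state reached by a nonempty physical word (`R2_nonneg_brun`).
Hence the DISCRIMINANT STEP (`alpha_step_of_disc`): if `A(v,u) ≥ 0`, `L₁ ≥ 0`, `R₂ ≥ 0` and `W² ≤ 4·R₂·L₁`, then `A(N_θ(v,u)) ≥ 0` for EVERY
letter `(s,d)` (no physicality needed).  Numerically (gen-67 memo §8) `W² ≤ 0.574·4R₂L₁` on all states of depth `≥ 2` and the same holds,
with ratio `≤ 0.52`, for every hub lookahead `ℓ_j = A∘N₀ʲ` in place of `A` — the 'lookahead hierarchy'; what is not yet a theorem is the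
invariance of the laws bounding the `m³` column that make `W² ≤ 4R₂L₁` hold.  [this work] (gen 67).
-/

namespace Summit.CriticalPhenomena.PercolationContinuityZ3.Theorems.ProductFormABPlus

/-- The hub lookahead functional `L₁ = (5/4)A − (3/2)t − (45/28)G + (1905/8)b̃ + (255/8)b̃₋ + 3ε`. [this work] -/
def lookL1 (v : StA) (u : StB) : ℚ :=
  (5/4) * (alphaA v + alphaB u) - (3/2) * v.t - (45/28) * (zOf v).G + (1905/8) * (zP v).b + (255/8) * (zP v).bm + 3 * u.E4

/-- The odd kick `W = 60η₋ − 30·o₁ − 30((3/4)f₁ + (37/16)f₂)`. [this work] -/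
def kickW (v : StA) (u : StB) : ℚ := 60 * (zP v).η - 30 * v.o1 - 30 * ((3/4) * u.f1 + (37/16) * u.f2)

/-- The `d²`-resource `R₂ = (5/4)(4v₁ + 23v₂) + (105/8)b̃ + (135/8)b̃₋ + 3ε`. [this work] -/
def resR2 (v : StA) (u : StB) : ℚ :=
  (5/4) * (4 * (zOf v).v₁ + 23 * (zOf v).v₂) + (105/8) * (zP v).b + (135/8) * (zP v).bm + 3 * u.E4

/-- ★ The recursion regrouped by powers of the letter: `A(N_θ(v,u)) = (d²/4)·A(v,u) + s²L₁ + sd·W + d²R₂`. [this work] -/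
theorem alpha_bstep_split (s d : ℚ) (v : StA) (u : StB) :
    alphaA (bstepA s d v) + alphaB (bstepB s d u) =
      (d ^ 2 / 4) * (alphaA v + alphaB u) + s ^ 2 * lookL1 v u + s * d * kickW v u + d ^ 2 * resR2 v u := by
  have h := alpha_bstep s d v u
  unfold lookL1 kickW resR2
  linear_combination h

/-- `L₁` IS the hub lookahead: `L₁(v,u) = A(N_{(1,0)}(v,u))`. [this work] -/
theorem L1_eq_hub (v : StA) (u : StB) : lookL1 v u = alphaA (bstepA 1 0 v) + alphaB (bstepB 1 0 u) := by
  rw [alpha_bstep_split]; ring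

/-- `R₂ ≥ 0` whenever `zOf v ∈ K_ℚ` (LEMMA Λ's cone), `zP v ∈ K_ψ` (LEMMA ψ's cone) and `ε ≥ 0`. [this work] -/
theorem resR2_nonneg_of_cones (v : StA) (u : StB) (hK : inK (zOf v)) (hP : inKP (zP v)) (hε : 0 ≤ u.E4) :
    0 ≤ resR2 v u := by
  have h1 := psi_v_nonneg_of_inK _ hK
  obtain ⟨_, hb, hbm, _⟩ := hP
  unfold resR2
  nlinarith

/-- `E4 = ε` stays nonnegative along physical words (it is multiplied by `s²`). [this work] -/
theorem E4_brunB_nonneg (w : List (ℚ × ℚ)) : 0 ≤ (brunB w omegaB).E4 := by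
  induction w with
  | nil => simp [brunB, omegaB]
  | cons θ w ih =>
    simp only [brunB, bstepB, combB, stepB, mul_zero, add_zero]
    positivity

/-- `R₂ ≥ 0` on every state reached by a NONEMPTY physical word. [this work] -/
theorem R2_nonneg_brun (w : List (ℚ × ℚ)) (hw : ∀ θ ∈ w, 0 ≤ θ.1 + θ.2 ∧ 0 ≤ θ.1 - θ.2) (hne : w ≠ []) :
    0 ≤ resR2 (brunA w omegaA) (brunB w omegaB) :=
  resR2_nonneg_of_cones _ _ (inK_brun w hw hne) (inKP_brun w hw) (E4_brunB_nonneg w)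

/-- Elementary: a binary quadratic form `L s² + W s d + R d²` with `L, R ≥ 0` and discriminant `W² ≤ 4RL` is nonnegative. [this work] -/
theorem binQuad_nonneg {L W R : ℚ} (hL : 0 ≤ L) (hR : 0 ≤ R) (hdisc : W ^ 2 ≤ 4 * R * L) (s d : ℚ) :
    0 ≤ L * s ^ 2 + W * s * d + R * d ^ 2 := by
  rcases eq_or_lt_of_le hR with hR0 | hRpos
  · -- R = 0 forces W = 0
    have hW : W = 0 := by
      have : W ^ 2 ≤ 0 := by rw [← hR0] at hdisc; linarith
      nlinarith [sq_nonneg W]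
    rw [← hR0, hW]; nlinarith [mul_nonneg hL (sq_nonneg s)]
  · -- 4R·(form) = (2Rd + Ws)² + s²(4RL − W²)
    have key : 4 * R * (L * s ^ 2 + W * s * d + R * d ^ 2) = (2 * R * d + W * s) ^ 2 + s ^ 2 * (4 * R * L - W ^ 2) := by ring
    have h4 : 0 ≤ 4 * R * (L * s ^ 2 + W * s * d + R * d ^ 2) := by
      rw [key]; nlinarith [sq_nonneg (2 * R * d + W * s), mul_nonneg (sq_nonneg s) (sub_nonneg.mpr hdisc)]
    by_contra hneg
    push Not at hneg
    have : 4 * R * (L * s ^ 2 + W * s * d + R * d ^ 2) < 0 := mul_neg_of_pos_of_neg (by linarith) hneg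
    linarith

/-- ★★ THE DISCRIMINANT STEP.  If at the state `(v,u)`: `A ≥ 0`, the hub lookahead `L₁ ≥ 0`, the resource `R₂ ≥ 0`, and the kick satisfies
`W² ≤ 4·R₂·L₁`, then `A(N_θ(v,u)) ≥ 0` for EVERY letter `θ = (s,d)` (physical or not). [this work] -/
theorem alpha_step_of_disc (v : StA) (u : StB) (hA : 0 ≤ alphaA v + alphaB u) (hL : 0 ≤ lookL1 v u)
    (hR : 0 ≤ resR2 v u) (hdisc : kickW v u ^ 2 ≤ 4 * resR2 v u * lookL1 v u) (s d : ℚ) :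
    0 ≤ alphaA (bstepA s d v) + alphaB (bstepB s d u) := by
  rw [alpha_bstep_split]
  have hq := binQuad_nonneg hL hR hdisc s d
  have hd : 0 ≤ (d ^ 2 / 4) * (alphaA v + alphaB u) := by positivity
  nlinarith

/-- The same along words: if the state of a physical word `w` (nonempty) has `A ≥ 0`, `L₁ ≥ 0` and `W² ≤ 4R₂L₁`, then every one-letter extension
`θ :: w` has `A ≥ 0` (`R₂ ≥ 0` being automatic). [this work] -/
theorem boxval_cons_nonneg_of_disc (θ : ℚ × ℚ) (w : List (ℚ × ℚ)) (hw : ∀ θ' ∈ w, 0 ≤ θ'.1 + θ'.2 ∧ 0 ≤ θ'.1 - θ'.2) (hne : w ≠ [])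
    (hA : 0 ≤ boxval w) (hL : 0 ≤ lookL1 (brunA w omegaA) (brunB w omegaB))
    (hdisc : kickW (brunA w omegaA) (brunB w omegaB) ^ 2
      ≤ 4 * resR2 (brunA w omegaA) (brunB w omegaB) * lookL1 (brunA w omegaA) (brunB w omegaB)) :
    0 ≤ boxval (θ :: w) := by
  rw [boxval_cons]
  exact alpha_step_of_disc _ _ hA hL (R2_nonneg_brun w hw hne) hdisc θ.1 θ.2

end Summit.CriticalPhenomena.PercolationContinuityZ3.Theorems.ProductFormABPlus
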